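import Literature.AlgebraicGeometry.Motives.WeilConjecturesForDiagonalHypersurface
import Literature.AlgebraicGeometry.Motives.DiagonalHypersurfaceSmooth
import Literature.AlgebraicGeometry.Motives.ProjectiveSpaceFiniteFieldCohomology
import HarnessLib

/-!
# The cohomology of the diagonal hypersurface `X = V₊(Σ βᵢ xᵢ^d) ⊂ ℙⁿ⁺¹` over `𝔽_q` (`d ∣ q − 1`, `n ≥ 1`)
# in a Galois Weil cohomology: `bᵢ(X) = [i even]` off the middle degree, `d·(b_n − [n even]) =
# (d−1)^{n+2} + (−1)ⁿ(d−1)`, `Pᵢ(X, T) = det(1 − TF | Hⁱ(X))` explicit, all classes off the middle algebraic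

Topic `Literature/AlgebraicGeometry/Motives`; THEOREMS ONLY (no definition, no instance, no named fact;
D-0026).  For a Galois Weil cohomology `E` over the finite field `k` (`q = #k`) with the Lefschetz trace formula and
`χ(φ) = q` — the setting of `Motives/ProjectiveSpaceFiniteFieldCohomology` (g48-#11), `Motives/PointCountsDetermineBettiNumbers`
— and the diagonal hypersurface `X = SmoothHypersurface.hypersurface (Σ C(βᵢ) xᵢ^d)` (`d ∣ q − 1`, `n = dim X ≥ 1`, units
`βᵢ`; SMOOTH PROJECTIVE of dimension `n` by `Motives/DiagonalHypersurfaceSmooth`, g49-#4, so no smoothness hypothesis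
appears), this file reads the Weil factorisation of `Z(X, T)` (`Motives/WeilConjecturesForDiagonalHypersurface`, g49-#3:
`Pᵢ = [i even](1 − q^{i/2}T)·[i = n]P`, `P = Π_{α∈s}(1 − αT)`, `|α| = q^{n/2}`, `d·#s = (d−1)^{n+2} + (−1)^{n+2}(d−1)`)
in `E` through the uniqueness of Weil factorisations (Deligne Th. (1.6); the tree's `IsWeilFactorization.unique`,
`isWeilFactorization_of_isIntegralModel`, `finrank_eq_natDegree_of_isIntegralModel`).  The Riemann hypothesis for `X`
IN `E` (`E.WeilRiemannHypothesisFor X n`) is a hypothesis throughout, as in g48-#11: it identifies the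
`det(1 − TF | Hⁱ(X))` inside `Z(X, T)`; nothing else is assumed.

Weil 1949, p. 507 (held `paper:doi-10-1090-s0002-9904-1949-09219-4` p0011, quoted in the tree's
`NumberTheory/GaussSums/FermatHypersurfaceZetaFunctionGeneral`): «Then one finds that the Poincaré polynomial … is
equal to `Σ_{j=0}^{r−1} X^{2j} + A·X^{r−1}`» (`r − 1 = dim = n`, `A` the number of his tuples `α`) and «This, and
other examples which we cannot discuss here, seem to lend some support to the following conjectural statements …
the degree of `P_h(U)` being equal to the `h`-th Betti number `B_h`».  Deligne 1982 §7 Prop. 7.4 ∕ 7.10 (2018 re-ed.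
pp. 48–50): `Hⁿ(V)_prim = ⊕_{a} Hⁿ(V)_a`, each a line, `F` acting by the Jacobi sum `J(ε^a)` — here only through
`P_n(X, T) = [n even](1 − q^{n/2}T) · Π_{α∈s}(1 − αT)`.

## What is here (`hE`, `hχ`, `hn : 0 < n`, `hd : d ∣ q − 1`, `hRH : E.WeilRiemannHypothesisFor X n`)

* **`finrank_diagonalHypersurface_of_ne`** — `bᵢ(X) = [i even ∧ i ≤ 2n]` for `i ≠ n` (the Betti numbers of
  `ℙⁿ⁺¹` off the middle); **`finrank_diagonalHypersurface_middle`** — `d·(b_n(X) − [n even]) = (d−1)^{n+2} +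
  (−1)ⁿ(d−1)` (Weil's `A`; Ireland–Rosen Remark (1)); `eulerChar_diagonalHypersurface`
  (`d·Σ_{i≤2n}(−1)ⁱbᵢ(X) = d(n+1) + (d−1) + (−1)ⁿ(d−1)^{n+2}`).
* **`frobCharPoly_diagonalHypersurface_of_ne`** — `Pᵢ(X,T) = det(1 − TF | Hⁱ(X)) = 1 − q^{i/2}T` (`i` even,
  `i ≤ 2n`, `i ≠ n`) and `= 1` (`i` odd, `i ≠ n`); **`exists_frobCharPoly_diagonalHypersurface_middle`** —
  `P_n(X,T) = [n even](1 − q^{n/2}T) · P(T)`, `P = Π_{α∈s}(1 − αT)`, `|α| = q^{n/2}`, `qⁿ/α ∈ s`,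
  `d·#s = (d−1)^{n+2} + (−1)^{n+2}(d−1)`.
* **`algebraicClasses_diagonalHypersurface_eq_top_of_ne`** — for `2r ≠ n` every class in `H^{2r}(X)` is algebraic
  (`H^{2r}(X) = K·ηʳ`, `η` the hyperplane class: `ηʳ ∪ η^{n−r} = ηⁿ ≠ 0` and `b_{2r} = 1`); hence
  **`tateConjectureFor_diagonalHypersurface_of_ne`** — Tate's `Tʳ(X)` holds for every `r` with `2r ≠ n` (the middle
  codimension `r = n/2` is Tate's theorem on Fermat hypersurfaces, NOT here).
* `finrank_fermatHypersurface_of_ne`, `finrank_fermatHypersurface_middle` for `V = V₊(Σ xᵢ^d)`.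

## References

* [Weil1949] A. Weil, Bull. AMS 55 (1949) 497–508, p. 507.
* [IrelandRosen1990] K. Ireland, M. Rosen, GTM 84, 2nd ed. (1990), Ch. 11 §3 Thm. 2, Remark (1), (a)–(d) p. 167.
* [Deligne1974] P. Deligne, La conjecture de Weil. I, Publ. Math. IHÉS 43 (1974), (1.5.4), Th. (1.6).
* [Deligne1982HodgeCycles] P. Deligne, LNM 900 (1982), §7 Prop. 7.4, Prop. 7.10.
* [Tate1994] J. Tate, Conjectures on algebraic cycles in ℓ-adic cohomology, PSPM 55.1 (1994), §1.
* [Hartshorne1977] R. Hartshorne, Algebraic Geometry, App. C §1 (1.3)–(1.4), §4.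
* Tree: `Motives/WeilConjecturesForDiagonalHypersurface` (g49-#3), `Motives/DiagonalHypersurfaceSmooth` (g49-#4),
  `Motives/ProjectiveSpaceFiniteFieldCohomology` (g48-#11, the pattern), `Motives/PointCountsDetermineBettiNumbers`,
  `NumberTheory/LFunctions/WeilConjecturesFactorizationProofs`.

## Provenance

Lane `lit-hodgefound` (summit `HodgeConjecture`, Track 2 foundations library, Layer B: motives / Weil cohomology over
finite fields), seat `lit-hodgefound-p29` (literature-prover, generation 49, row g49-#5).
-/

universe u v

open Polynomial

noncomputable section

namespace Literature.AlgebraicGeometry.Motives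

namespace GaloisWeilCohomology

open Literature.NumberTheory.LFunctions (isWeilFactorization_of_isIntegralModel)
open SmoothHypersurface

variable {k : Type u} [Field k] [Finite k] {K : Type v} [Field K] [CharZero K]
  {χ : Field.absoluteGaloisGroup k →* Kˣ} (E : GaloisWeilCohomology k K χ)
variable {n d : ℕ} {β : Fin (n + 2) → kˣ}

/-- `1 − qʳT ∈ ℤ[T]` base-changed along a ring map: `1 − qʳT` (private helper). [folklore] -/
private theorem map_one_sub_C_pow_mul_X {R : Type*} [CommRing R] (f : ℤ →+* R) (q r : ℕ) :
    ((1 - C ((q : ℤ) ^ r) * X : ℤ[X]).map f) = 1 - C ((q : R) ^ r) * X := by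
  rw [Polynomial.map_sub, Polynomial.map_one, Polynomial.map_mul, Polynomial.map_C, Polynomial.map_X,
    map_pow, map_natCast]

/-! ### §1 Betti numbers -/

/-- **The Betti numbers of the diagonal hypersurface off the middle degree: `bᵢ(X) = 1` for `i` even,
`i ≤ 2n`, `i ≠ n`, and `bᵢ(X) = 0` otherwise (`i ≠ n`)** — Weil's Poincaré polynomial `Σ_{j=0}^{n} X^{2j} + A·Xⁿ`
read in a Galois Weil cohomology `E` with the trace formula and `χ(φ) = q`, granted the Riemann hypothesis for `X`
in `E` (`Bᵢ = deg Pᵢ`, Hartshorne (1.4); uniqueness of the `Pᵢ`, Deligne Th. (1.6)).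
[cite: Weil1949, p. 507] [cite: Hartshorne1977, App. C §1 (1.4)] [cite: Deligne1974, Th. (1.6)] -/
theorem finrank_diagonalHypersurface_of_ne (hE : E.HasLefschetzTraceFormula)
    (hχ : ((χ (arithFrob k) : Kˣ) : K) = Nat.card k) (hn : 0 < n) (hd : d ∣ Nat.card k - 1)
    (hRH : E.WeilRiemannHypothesisFor
      (hypersurface (∑ i, MvPolynomial.C (β i : k) * MvPolynomial.X i ^ d : MvPolynomial (Fin (n + 2)) k)) n)
    {i : ℕ} (hi : i ≠ n) :
    Module.finrank K (E.obj
      (hypersurface (∑ i, MvPolynomial.C (β i : k) * MvPolynomial.X i ^ d : MvPolynomial (Fin (n + 2)) k)) i) =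
      if Even i ∧ i ≤ 2 * n then 1 else 0 := by
  have hX := isSmoothProjective_diagonalHypersurface_of_dvd hn hd β
  rcases le_or_gt i (2 * n) with hi2 | hi2
  · obtain ⟨P, hP, hroots⟩ := hRH
    have hW := isWeilFactorization_of_isIntegralModel E hE hχ hX hP hroots
    obtain ⟨ι, rfl⟩ : ∃ ι : Fin (2 * n + 1), (ι : ℕ) = i := ⟨⟨i, by omega⟩, rfl⟩
    rw [E.finrank_eq_natDegree_of_isIntegralModel hX (hP ι), hW.natDegree_eq_of_ne_of_diagonalHypersurface hn hd hi]
    simp only [hi2, and_true]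
  · rw [E.finrank_obj_eq_zero hX hi2, if_neg (fun h => absurd h.2 (not_le.mpr hi2))]

/-- **The middle Betti number of the diagonal hypersurface**: `d · (b_n(X) − [n even]) = (d − 1)^{n+2} + (−1)ⁿ(d − 1)`
— Weil's `A` («the Poincaré polynomial … `Σ_{j=0}^{r−1} X^{2j} + A·X^{r−1}`», `A` = the number of tuples `α`),
Ireland–Rosen's Remark (1) ∕ (d) `deg P = d⁻¹[(d−1)^{n+1} + (−1)^{n+1}(d−1)]` (their `n + 1` variables = our `n + 2`),
in `E` under the trace formula, `χ(φ) = q` and the Riemann hypothesis for `X` in `E`.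
[cite: Weil1949, p. 507] [cite: IrelandRosen1990, Ch. 11 §3, Remark (1) and statement (d) p. 167] [cite: Deligne1974, Th. (1.6)] -/
theorem finrank_diagonalHypersurface_middle (hE : E.HasLefschetzTraceFormula)
    (hχ : ((χ (arithFrob k) : Kˣ) : K) = Nat.card k) (hn : 0 < n) (hd : d ∣ Nat.card k - 1)
    (hRH : E.WeilRiemannHypothesisFor
      (hypersurface (∑ i, MvPolynomial.C (β i : k) * MvPolynomial.X i ^ d : MvPolynomial (Fin (n + 2)) k)) n) :
    (d : ℤ) * ((Module.finrank K (E.obj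
      (hypersurface (∑ i, MvPolynomial.C (β i : k) * MvPolynomial.X i ^ d : MvPolynomial (Fin (n + 2)) k)) n) : ℤ) -
        if Even n then 1 else 0) = ((d : ℤ) - 1) ^ (n + 2) + (-1) ^ (n + 2) * ((d : ℤ) - 1) := by
  have hX := isSmoothProjective_diagonalHypersurface_of_dvd hn hd β
  obtain ⟨P, hP, hroots⟩ := hRH
  have hW := isWeilFactorization_of_isIntegralModel E hE hχ hX hP hroots
  have h := E.finrank_eq_natDegree_of_isIntegralModel hX (hP ⟨n, by omega⟩)
  dsimp only at h
  rw [h]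
  exact hW.natDegree_middle_of_diagonalHypersurface hn hd

/-- **The Euler characteristic of the diagonal hypersurface in `E`**: `d · Σ_{i=0}^{2n} (−1)ⁱ bᵢ(X) = d(n+1) + (d−1) +
(−1)ⁿ(d−1)^{n+2}` (i.e. `χ(X) = n + 2 + ((1−d)^{n+2} − 1)/d`; Hartshorne (1.4) `E = Σ(−1)ⁱBᵢ`).
[cite: Weil1949, p. 507] [cite: Hartshorne1977, App. C §1 (1.2) and (1.4)] -/
theorem eulerChar_diagonalHypersurface (hE : E.HasLefschetzTraceFormula)
    (hχ : ((χ (arithFrob k) : Kˣ) : K) = Nat.card k) (hn : 0 < n) (hd : d ∣ Nat.card k - 1)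
    (hRH : E.WeilRiemannHypothesisFor
      (hypersurface (∑ i, MvPolynomial.C (β i : k) * MvPolynomial.X i ^ d : MvPolynomial (Fin (n + 2)) k)) n) :
    (d : ℤ) * ∑ i : Fin (2 * n + 1), (-1 : ℤ) ^ (i : ℕ) * (Module.finrank K (E.obj
      (hypersurface (∑ i, MvPolynomial.C (β i : k) * MvPolynomial.X i ^ d : MvPolynomial (Fin (n + 2)) k)) i) : ℤ) =
      d * (n + 1) + ((d : ℤ) - 1) + (-1) ^ n * ((d : ℤ) - 1) ^ (n + 2) := by
  have hX := isSmoothProjective_diagonalHypersurface_of_dvd hn hd β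
  obtain ⟨P, hP, hroots⟩ := hRH
  have hW := isWeilFactorization_of_isIntegralModel E hE hχ hX hP hroots
  rw [← hW.eulerChar_of_diagonalHypersurface hn hd]
  congr 1
  refine Finset.sum_congr rfl fun ι _ => ?_
  rw [E.finrank_eq_natDegree_of_isIntegralModel hX (hP ι)]

/-! ### §2 The characteristic polynomials of Frobenius -/

/-- **`Pᵢ(X, T) = det(1 − TF | Hⁱ(X))` off the middle degree**: for `i ≤ 2n`, `i ≠ n`, `Pᵢ(X, T) = 1 − q^{i/2}T` if
`i` is even (the class `η^{i/2}` with `F = q^{i/2}`, as on `ℙⁿ⁺¹`) and `Pᵢ(X, T) = 1` if `i` is odd — in `E` under the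
trace formula, `χ(φ) = q` and the Riemann hypothesis for `X` in `E` (Weil p. 507 «`P_h(U) = Π(1 − α_{hi}U)`»; Deligne
(1.5.4), Th. (1.6)). [cite: Weil1949, p. 507] [cite: Deligne1974, (1.5.4) and Th. (1.6)] -/
theorem frobCharPoly_diagonalHypersurface_of_ne (hE : E.HasLefschetzTraceFormula)
    (hχ : ((χ (arithFrob k) : Kˣ) : K) = Nat.card k) (hn : 0 < n) (hd : d ∣ Nat.card k - 1)
    (hRH : E.WeilRiemannHypothesisFor
      (hypersurface (∑ i, MvPolynomial.C (β i : k) * MvPolynomial.X i ^ d : MvPolynomial (Fin (n + 2)) k)) n)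
    {i : ℕ} (hi : i ≠ n) (hi2 : i ≤ 2 * n) :
    E.frobCharPoly
      (hypersurface (∑ i, MvPolynomial.C (β i : k) * MvPolynomial.X i ^ d : MvPolynomial (Fin (n + 2)) k)) i =
      if Even i then 1 - C ((Nat.card k : K) ^ (i / 2)) * X else 1 := by
  have hX := isSmoothProjective_diagonalHypersurface_of_dvd hn hd β
  obtain ⟨P, hP, hroots⟩ := hRH
  have hW := isWeilFactorization_of_isIntegralModel E hE hχ hX hP hroots
  obtain ⟨ι, rfl⟩ : ∃ ι : Fin (2 * n + 1), (ι : ℕ) = i := ⟨⟨i, by omega⟩, rfl⟩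
  have h := hP ι
  rw [IsIntegralModel, hW.eq_of_ne_of_diagonalHypersurface hn hd hi] at h
  rw [← h]
  split_ifs
  · exact map_one_sub_C_pow_mul_X _ _ _
  · exact Polynomial.map_one _

/-- **The middle factor `P_n(X, T) = det(1 − TF | Hⁿ(X))`**: there are `P ∈ ℤ[T]` and `s ⊂ ℂ` with
`P = Π_{α∈s}(1 − αT)` over `ℂ`, `|α| = q^{n/2}` and `qⁿ/α ∈ s` for `α ∈ s`, `d·#s = (d−1)^{n+2} + (−1)^{n+2}(d−1)`, and
`P_n(X, T) = [n even](1 − q^{n/2}T) · P(T)` in `K[T]` — the `α` being Weil's reciprocal roots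
`(−1)ⁿq⁻¹Πχ^{aᵢ}(βᵢ⁻¹)Πg(χ^{aᵢ})` (for the Fermat hypersurface Deligne's Jacobi sums `J(ε^a)`, the eigenvalues of
`F` on `Hⁿ(V)_prim = ⊕_a Hⁿ(V)_a`, Prop. 7.4 ∕ 7.10), in `E` under the trace formula, `χ(φ) = q` and the Riemann
hypothesis for `X` in `E`. [cite: Weil1949, p. 507] [cite: Deligne1982HodgeCycles, §7, Prop. 7.4 and Prop. 7.10]
[cite: Deligne1974, Th. (1.6)] -/
theorem exists_frobCharPoly_diagonalHypersurface_middle (hE : E.HasLefschetzTraceFormula)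
    (hχ : ((χ (arithFrob k) : Kˣ) : K) = Nat.card k) (hn : 0 < n) (hd : d ∣ Nat.card k - 1)
    (hRH : E.WeilRiemannHypothesisFor
      (hypersurface (∑ i, MvPolynomial.C (β i : k) * MvPolynomial.X i ^ d : MvPolynomial (Fin (n + 2)) k)) n) :
    ∃ (P : ℤ[X]) (s : Multiset ℂ),
      P.map (Int.castRingHom ℂ) = (s.map fun α => 1 - C α * X).prod ∧
      (∀ α ∈ s, ‖α‖ = Real.sqrt (Nat.card k) ^ n ∧ (Nat.card k : ℂ) ^ n / α ∈ s) ∧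
      (d : ℤ) * Multiset.card s = ((d : ℤ) - 1) ^ (n + 2) + (-1) ^ (n + 2) * ((d : ℤ) - 1) ∧
      E.frobCharPoly
          (hypersurface (∑ i, MvPolynomial.C (β i : k) * MvPolynomial.X i ^ d : MvPolynomial (Fin (n + 2)) k)) n =
        ((if Even n then 1 - C ((Nat.card k : ℤ) ^ (n / 2)) * X else 1) * P).map (Int.castRingHom K) := by
  have hX := isSmoothProjective_diagonalHypersurface_of_dvd hn hd β
  obtain ⟨P, hP, hroots⟩ := hRH
  have hW := isWeilFactorization_of_isIntegralModel E hE hχ hX hP hroots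
  obtain ⟨P₀, s, hmap, hns, hcard, hW₀⟩ := exists_isWeilFactorization_diagonalHypersurface hn hd β
  refine ⟨P₀, s, hmap, hns, hcard, ?_⟩
  have h := hP ⟨n, by omega⟩
  rw [IsIntegralModel, hW.unique Finite.one_lt_card hW₀] at h
  rw [← h]
  dsimp only
  rw [if_pos rfl]

/-! ### §3 Algebraic classes and the Tate conjecture off the middle codimension -/

/-- **Every class in `H^{2r}(X)` is algebraic for `2r ≠ n`: `H^{2r}(X) = K·ηʳ`** (`η` a hyperplane class of `X`):
`ηʳ` is algebraic and non-zero since `ηʳ ∪ η^{n−r} = ηⁿ ≠ 0` (`deg X > 0`; the tree's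
`exists_isHyperplaneClass_pow_ne_zero`, `cup_pow_pow`), and `b_{2r}(X) = 1` off the middle; beyond `2n` the groups
vanish.  In `E` under the trace formula, `χ(φ) = q` and the Riemann hypothesis for `X` in `E`.
[cite: Weil1949, p. 507] [cite: Tate1994, §1 Conjecture T^r] -/
theorem algebraicClasses_diagonalHypersurface_eq_top_of_ne (hE : E.HasLefschetzTraceFormula)
    (hχ : ((χ (arithFrob k) : Kˣ) : K) = Nat.card k) (hn : 0 < n) (hd : d ∣ Nat.card k - 1)
    (hRH : E.WeilRiemannHypothesisFor
      (hypersurface (∑ i, MvPolynomial.C (β i : k) * MvPolynomial.X i ^ d : MvPolynomial (Fin (n + 2)) k)) n)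
    {r : ℕ} (hr : 2 * r ≠ n) :
    E.algebraicClasses
      (hypersurface (∑ i, MvPolynomial.C (β i : k) * MvPolynomial.X i ^ d : MvPolynomial (Fin (n + 2)) k)) r = ⊤ := by
  have hX := isSmoothProjective_diagonalHypersurface_of_dvd hn hd β
  set Y := hypersurface (∑ i, MvPolynomial.C (β i : k) * MvPolynomial.X i ^ d : MvPolynomial (Fin (n + 2)) k)
    with hY
  rcases Nat.lt_or_ge n r with hnr | hrn
  · haveI := E.subsingleton_obj hX (show 2 * n < 2 * r by omega)
    exact eq_top_iff.2 fun x _ => by rw [Subsingleton.elim x 0]; exact Submodule.zero_mem _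
  · obtain ⟨η, hη, hne⟩ := E.exists_isHyperplaneClass_pow_ne_zero hX hn
    have hr_ne : E.pow Y η r ≠ 0 := by
      intro h0
      apply hne
      rw [← E.cup_pow_pow hX η r (n - r) n (by omega) (by omega), h0, LinearMap.map_zero₂]
    have hmem : E.pow Y η r ∈ E.algebraicClasses Y r :=
      E.pow_mem_algebraicClasses hX (E.hyperplaneClass_mem_algebraicClasses hX hη) r
    have hone : Module.finrank K (E.obj Y (2 * r)) = 1 := by
      rw [E.finrank_diagonalHypersurface_of_ne hE hχ hn hd hRH hr, if_pos ⟨even_two_mul r, by omega⟩]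
    haveI := E.finite_obj hX (2 * r)
    rw [eq_top_iff]
    rintro x -
    obtain ⟨c, hc⟩ := (finrank_eq_one_iff_of_nonzero' (E.pow Y η r) hr_ne).mp hone x
    rw [← hc]
    exact Submodule.smul_mem _ c hmem

/-- **The Tate conjecture `Tʳ(X)` for the diagonal hypersurface holds in every codimension `r` with `2r ≠ n`**
(in `E`, under the trace formula, `χ(φ) = q` and the Riemann hypothesis for `X` in `E`): `K·Aʳ(X) =
(H^{2r}(X)(r))^{Γ_k}`, both being all of `H^{2r}(X) = K·ηʳ`.  (The middle codimension `2r = n`, where the Galois-fixed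
part of `⊕_a Hⁿ(V)_a(r)` is spanned by classes of linear subvarieties — Tate's theorem for Fermat hypersurfaces — is
NOT here.) [cite: Tate1994, §1 Conjecture T^r] [cite: Weil1949, p. 507] -/
theorem tateConjectureFor_diagonalHypersurface_of_ne (hE : E.HasLefschetzTraceFormula)
    (hχ : ((χ (arithFrob k) : Kˣ) : K) = Nat.card k) (hn : 0 < n) (hd : d ∣ Nat.card k - 1)
    (hRH : E.WeilRiemannHypothesisFor
      (hypersurface (∑ i, MvPolynomial.C (β i : k) * MvPolynomial.X i ^ d : MvPolynomial (Fin (n + 2)) k)) n)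
    {r : ℕ} (hr : 2 * r ≠ n) :
    E.TateConjectureFor
      (hypersurface (∑ i, MvPolynomial.C (β i : k) * MvPolynomial.X i ^ d : MvPolynomial (Fin (n + 2)) k)) r :=
  le_antisymm (E.algebraicClasses_le_invariants (isSmoothProjective_diagonalHypersurface_of_dvd hn hd β) r) (by
    rw [E.algebraicClasses_diagonalHypersurface_eq_top_of_ne hE hχ hn hd hRH hr]
    exact le_top)

/-! ### §4 The Fermat hypersurface `V = V₊(x₀^d + ⋯ + x_{n+1}^d)` -/

/-- **`bᵢ(V) = [i even ∧ i ≤ 2n]` for `i ≠ n`** for the Fermat hypersurface `V = V₊(Σ xᵢ^d)` (`d ∣ q − 1`, `n ≥ 1`),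
in `E` under the trace formula, `χ(φ) = q` and the Riemann hypothesis for `V` in `E`. [cite: Weil1949, p. 507]
[cite: Deligne1982HodgeCycles, §7, Prop. 7.4] -/
theorem finrank_fermatHypersurface_of_ne (hE : E.HasLefschetzTraceFormula)
    (hχ : ((χ (arithFrob k) : Kˣ) : K) = Nat.card k) (hn : 0 < n) (hd : d ∣ Nat.card k - 1)
    (hRH : E.WeilRiemannHypothesisFor (hypersurface (fermatPolynomial k n d)) n) {i : ℕ} (hi : i ≠ n) :
    Module.finrank K (E.obj (hypersurface (fermatPolynomial k n d)) i) = if Even i ∧ i ≤ 2 * n then 1 else 0 := by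
  rw [← sum_C_one_mul_X_pow_eq_fermatPolynomial] at hRH ⊢
  exact E.finrank_diagonalHypersurface_of_ne hE hχ hn hd hRH hi

/-- **`d · (b_n(V) − [n even]) = (d−1)^{n+2} + (−1)ⁿ(d−1)`** for the Fermat hypersurface `V = V₊(Σ xᵢ^d)`: the
primitive middle cohomology `Hⁿ(V)_prim = ⊕_{a : no aᵢ = 0} Hⁿ(V)_a` has rank `#{a ∈ (ℤ/d)^{n+2} : Σaᵢ = 0, aᵢ ≠ 0}`
(Deligne Prop. 7.4; Weil's `A`), in `E` under the trace formula, `χ(φ) = q` and RH for `V` in `E`.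
[cite: Deligne1982HodgeCycles, §7, Prop. 7.4] [cite: Weil1949, p. 507] [cite: IrelandRosen1990, Ch. 11 §3, Remark (1)] -/
theorem finrank_fermatHypersurface_middle (hE : E.HasLefschetzTraceFormula)
    (hχ : ((χ (arithFrob k) : Kˣ) : K) = Nat.card k) (hn : 0 < n) (hd : d ∣ Nat.card k - 1)
    (hRH : E.WeilRiemannHypothesisFor (hypersurface (fermatPolynomial k n d)) n) :
    (d : ℤ) * ((Module.finrank K (E.obj (hypersurface (fermatPolynomial k n d)) n) : ℤ) - if Even n then 1 else 0) =
      ((d : ℤ) - 1) ^ (n + 2) + (-1) ^ (n + 2) * ((d : ℤ) - 1) := by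
  rw [← sum_C_one_mul_X_pow_eq_fermatPolynomial] at hRH ⊢
  exact E.finrank_diagonalHypersurface_middle hE hχ hn hd hRH

end GaloisWeilCohomology

end Literature.AlgebraicGeometry.Motives
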